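import Summits.HodgeConjecture.HodgeConjecture.Theorems.SignSymmetricPowersPencilKernel
import Summits.HodgeConjecture.HodgeConjecture.Theorems.SignSymmetricPowersClose
import Summits.HodgeConjecture.HodgeConjecture.Theorems.SignSymmetricPowersMeridianChart
import Summits.HodgeConjecture.HodgeConjecture.Theorems.SignSymmetricPowersFibreCoreC
import Summits.HodgeConjecture.HodgeConjecture.Theorems.SmoothHypersurfaceGeometricGenus
import Summits.HodgeConjecture.HodgeConjecture.Theorems.SignSymmetricPowersFourFactsGeometricGenus
import Summits.HodgeConjecture.HodgeConjecture.Theorems.SignSymmetricPowersModelTransfer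
import Literature.AlgebraicGeometry.HodgeTheory.MonomialPencilMonodromyMumfordTate
import Literature.AlgebraicGeometry.HodgeTheory.GriffithsHolomorphicHodgeSubbundlesQP
import Literature.AlgebraicGeometry.HodgeTheory.UniversalHypersurfaceDiscriminantExists
import Literature.AlgebraicGeometry.FundamentalGroup.HypersurfaceComplementPencilDiscriminantRadical
import Literature.AlgebraicGeometry.FundamentalGroup.HypersurfaceComplementMeridiansGenerate
import Literature.AlgebraicGeometry.HodgeTheory.A3PencilCircleTransportNotUnipotent
import HarnessLib

/-!
# Route `SignSymmetricPowers` — reading (a″)-B «PENCIL-B»: on every pencil `f₀ + u·g` of ι-even threefolds from a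
# ZARISKI-OPEN set of pencils, the Hodge conjecture holds on all powers of ALL BUT COUNTABLY MANY members
# (modulo Griffiths' holomorphy of the Hodge bundles and the keyed symmetric-`A₃` binder hN′; NO Cattani–Deligne–Kaplan)

Support file for crux K1-B `VeryGeneralSignCommutatorsInHg` (stmt-HodgeConjecture-19716; `--supports … --as helper`, nothing
here closes an item).  Prover seat `hodge-nonav-prover-Ax` (g15, cell `hodge-nonav`), programme PENCIL-B assigned by the route
owner hodge-nonav-p3 (g35, STATUS 2026-08-29T02:18:13Z ∕ 02:21:41Z; typed target `HOME/p3/pencilB/PencilBTarget.lean`,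
referee glance ref g67 PASS): the route-B twin, ONE DIMENSION UP, of route A's
`CyclicUnitaryPowersGenericPencilsHodgeOffCountable.exists_polynomial_pencils_hodge_offCountable_forms`.

THE CHAIN (tree theorems; `Griffiths1968_holomorphicHodgeSubbundles[QP]` and hN′ are HYPOTHESES): (F) the pencil `ι : P ⟶ S_{M_ι}` of
`familyM ℂ 3 d M_ι` (`MonomialSupportedLinearPencil`); (Z)(G)(D)(T) `MonomialPencil.identityComponent_le_mumfordTate_offCountable_of_pencil_QP`
(Zariski for the pencil, Griffiths ⇒ countably many non-generic points over the CURVE, Deligne (i), MT transport ⇒ off countably many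
`c`, `(Γ_{ι c}^Zar)⁰ ⊆ MT`); (K) the pointwise kernel `SignSymmetricPowersPencilKernel.signModel_of_identityComponent_le_mumfordTate`;
(MT) model transfer (body of `stub_modelTransfer`); (P) K2-B `SignSymmetricPowersClose.powersHodgeOfSignCommutators`.  The ZARISKI-OPEN
CONDITION on `(f₀, g)`: `pencilDiscr h′ ≠ 0` for the REDUCED equation `h′` (`exists_sameZeros_pencilDiscr_ne_zero`, seat 19716-p2) of the
restricted discriminant `killHom Disc` (chart `SignSymmetricPowersMeridianChart.range_coeffChart_eq`); non-vacuity by `MvPolynomial.funext`.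

MAIN STATEMENTS: `hodgeConjectureFor_signPowers_offCountable_of_pencil`, **`signThreefoldPowersHodgeGeneralPencil`** (the
typed target `SignThreefoldPowersHodgeGeneralPencil` of p3's file, verbatim, from `hGr` and hN′), `pencilBTarget`.

HONEST FRAMING: CONDITIONAL on {Griffiths 1968 (print theorem, named fact), hN′ (`stub_a3NonCommOdd`, registry v25k — a cell
theorem in progress)}; the exceptional set on each pencil is countable and unspecified; pencils form a Zariski-dense family of
one-parameter sub-families, NOT «very general in ℂ^N» (that is item 19716 ∕ 19715 modulo hCDK, which stay OPEN); rung F-H1 not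
moved; nothing here says HC ∕ HC_CM ∕ HC_AV is proved.

## References
* [Deligne1972WeilK3] P. Deligne, La conjecture de Weil pour les surfaces K3, Invent. Math. 15 (1972), Prop. 7.5.
* [VoisinHodgeI2002] C. Voisin, Hodge Theory and Complex Algebraic Geometry I, §10.2.1 Thm. 10.3.
* [VoisinHodgeII2003] C. Voisin, Hodge Theory and Complex Algebraic Geometry II, §3.2.2 Thm. 3.22, §6.1.3, §6.2.1.
* [Dimca1992] A. Dimca, Singularities and Topology of Hypersurfaces (1992), Ch. 4 §3 Prop. (3.1).
* [CarlsonMullerStachPeters2017] J. Carlson, S. Müller-Stach, C. Peters, Period Mappings and Period Domains, L.-D. 15.3.7.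
-/

noncomputable section

set_option linter.dupNamespace false
set_option maxHeartbeats 800000

namespace Summit.HodgeConjecture.HodgeConjecture.Theorems.SignSymmetricPowersGeneralPencil

open scoped TensorProduct Topology
open CategoryTheory CategoryTheory.Limits AlgebraicGeometry Set
open _root_.Topology _root_.Filter
open Literature.AlgebraicGeometry.Motives Literature.AlgebraicGeometry.HodgeTheory
open Literature.AlgebraicGeometry.HodgeTheory.BettiUniverse
open Literature.AlgebraicGeometry.Motives.UniversalHypersurface Literature.AlgebraicGeometry.HodgeTheory.UniversalHypersurface
open Literature.AlgebraicGeometry.HodgeTheory.MonomialPencil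
open Literature.AlgebraicGeometry.FundamentalGroup
open Literature.AlgebraicTopology.SingularHomology
open Literature.AlgebraicGeometry.Motives.SmoothHypersurface (IsNonsingularForm)
open Summit.HodgeConjecture.HodgeConjecture.Theorems.SignSymmetricPowersConfluenceLinkG (isSupportedOn_of_coeff_odd_eq_zero)
open Summit.HodgeConjecture.HodgeConjecture.Theorems.SignSymmetricPowersFourFactsGeometricGenus (signDeckHodge_of_genusBound)
open Summit.HodgeConjecture.HodgeConjecture.Theorems.SmoothHypersurfaceGeometricGenus (stub_genusBoundThreefold)

/-! ### §1 HC on all powers of all but countably many members of a transversal pencil of ι-even threefolds -/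

/-- **HC on all powers of all but countably many members of a transversal pencil of ι-even threefolds** (modulo the
quasi-projective form of Griffiths' theorem and hN′).  `d` even `≥ 4`; `h` an equation of the ι-even singular locus READ THROUGH a coefficient chart
`χ : S_{M_ι}(ℂ) ≃ₜ ℂ^{M_ι} ∖ V(h)`; `F₀, G` ι-even quinary forms of degree `d` with `(coeff_m G)_m ≠ 0` and
`pencilDiscr h (coeff F₀, coeff G) ≠ 0`.  Then there is a COUNTABLE `C ⊆ ℂ` such that for `u ∉ C` every smooth projective
threefold `X ⊂ ℙ⁴` cut out by `F₀ + u·G` and every self fibre power `Y = X^{k+1}` satisfy `HodgeConjectureFor (3(k+1)) Y`.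
[cite: Deligne1972WeilK3, Prop. 7.5] [cite: VoisinHodgeII2003, §3.2.2 Thm. 3.22 and §6.2.1] [cite: Dimca1992, Ch. 4 §3 Prop. (3.1)] -/
theorem hodgeConjectureFor_signPowers_offCountable_of_pencil (hGr : Griffiths1968_holomorphicHodgeSubbundlesQP)
    (hNC : ∀ (n d : ℕ) (f₁ g₀ g₂ : MvPolynomial (Fin (n + 2)) ℂ) (j k : Fin (n + 2)) (a : Fin (n + 2) → ℂˣ),
      1 ≤ n → 1 ≤ d → Odd n → (∃ (i : Fin (n + 2)) (c : ℂ), g₀ = c • MvPolynomial.X i ^ d) →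
      f₁.IsHomogeneous d → g₀.IsHomogeneous d → g₂.IsHomogeneous d → IsSymmetricA3Datum f₁ g₀ g₂ j k a →
      ∀ (εa εb : ℝ) (ψ : ℂ → ℂ), IsSymmetricA3Bifurcation f₁ g₀ g₂ j a εa εb ψ →
        ∃ εa' : ℝ, 0 < εa' ∧ εa' ≤ εa ∧ SymmetricA3NonCommutation n d f₁ g₀ g₂ ψ εa')
    {d : ℕ} (hd : Even d) (h4 : 4 ≤ d) {h : MvPolynomial {m : DegIndex 3 d | Even (m.1 0 + m.1 1)} ℂ}
    (χ : ComplexPoints (baseM ℂ 3 d {m : DegIndex 3 d | Even (m.1 0 + m.1 1)}) ≃ₜ affineHypersurfaceComplement ![h])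
    (hχ : ∀ (t : ComplexPoints (baseM ℂ 3 d {m : DegIndex 3 d | Even (m.1 0 + m.1 1)}))
      (m : {m : DegIndex 3 d | Even (m.1 0 + m.1 1)}),
      (χ t : {m : DegIndex 3 d | Even (m.1 0 + m.1 1)} → ℂ) m = MvPolynomial.coeff m.1.1 (pointFormM ℂ 3 d _ t))
    {F₀ G : MvPolynomial (Fin 5) ℂ} (hF₀ : F₀.IsHomogeneous d) (hG : G.IsHomogeneous d)
    (hevF : ∀ e : Fin 5 →₀ ℕ, ¬ Even (e 0 + e 1) → F₀.coeff e = 0) (hevG : ∀ e : Fin 5 →₀ ℕ, ¬ Even (e 0 + e 1) → G.coeff e = 0)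
    (hg : coeffsM 3 d {m : DegIndex 3 d | Even (m.1 0 + m.1 1)} G ≠ 0)
    (hQ : MvPolynomial.eval (Sum.elim (coeffsM 3 d {m : DegIndex 3 d | Even (m.1 0 + m.1 1)} F₀)
      (coeffsM 3 d {m : DegIndex 3 d | Even (m.1 0 + m.1 1)} G)) (pencilDiscr h) ≠ 0) :
    ∃ C : Set ℂ, C.Countable ∧ ∀ u : ℂ, u ∉ C →
      ∀ ⦃X : SchemeOver ℂ⦄, IsSmoothProjective 3 X → IsHypersurfaceCutOutBy 4 (F₀ + MvPolynomial.C u * G) X →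
        ∀ ⦃k : ℕ⦄ ⦃Y : SchemeOver ℂ⦄, (∃ π : Fin (k + 1) → (Y ⟶ X), Nonempty (IsLimit (Fan.mk Y π))) →
          HodgeConjectureFor (3 * (k + 1)) Y := by
  classical
  haveI hHTF : HodgeTensorFacts.{0, 0} := hodgeTensorFacts_holds
  -- ### (K) the pointwise kernel on the named family
  have hK := SignSymmetricPowersPencilKernel.signModel_of_identityComponent_le_mumfordTate
    (signDeckHodge_of_genusBound stub_genusBoundThreefold) affineHypersurfaceComplement_meridians_normalClosure_eq_top_holds
    discriminant_localBranches_nodal_holds hNC affineHypersurfaceComplement_meridian_isConj_holds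
  obtain ⟨hu, hU, A, hA, hfin, t₀, hK⟩ := hK hd h4
  have hMF : IsSupportedOn 3 d {m : DegIndex 3 d | Even (m.1 0 + m.1 1)} F₀ := isSupportedOn_of_coeff_odd_eq_zero hevF
  have hMG : IsSupportedOn 3 d {m : DegIndex 3 d | Even (m.1 0 + m.1 1)} G := isSupportedOn_of_coeff_odd_eq_zero hevG
  -- ### (Z)+(G)+(D)+(T) the countable exceptional set of points of the pencil
  obtain ⟨C, hCc, hC⟩ := identityComponent_le_mumfordTate_offCountable_of_pencil_QP hGr (by omega)
    {m : DegIndex 3 d | Even (m.1 0 + m.1 1)} 3 hu hU A hA χ hχ hg hQ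
  have hf₀U : coeffsM 3 d {m : DegIndex 3 d | Even (m.1 0 + m.1 1)} F₀ ∈ affineHypersurfaceComplement ![h] :=
    mem_affineHypersurfaceComplement_of_pencilDiscr hQ
  -- ### the countable exceptional set of parameters
  refine ⟨pencilCoord 3 d _ (coeffsM 3 d _ F₀) (coeffsM 3 d _ G) '' C ∪
      {u | MvPolynomial.eval (coeffsM 3 d {m : DegIndex 3 d | Even (m.1 0 + m.1 1)} F₀ +
        u • coeffsM 3 d {m : DegIndex 3 d | Even (m.1 0 + m.1 1)} G) h = 0},
    (hCc.image _).union ?_, fun u hu' X hX hcut k Y hY => ?_⟩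
  · -- the parameters with `h(f₀ + u g) = 0` are finitely many (`h(f₀) ≠ 0`)
    refine ((lineRoots_finite hf₀U (coeffsM 3 d _ G)).subset fun u hu => ?_).countable
    exact ⟨0, hu⟩
  rw [mem_union, not_or] at hu'
  obtain ⟨hu1, hu2⟩ := hu'
  -- the point of the pencil with coordinate `u` (through the chart: `f₀ + u g ∈ ℂ^M ∖ V(h)`)
  have hmem : coeffsM 3 d {m : DegIndex 3 d | Even (m.1 0 + m.1 1)} F₀ +
      u • coeffsM 3 d {m : DegIndex 3 d | Even (m.1 0 + m.1 1)} G ∈ affineHypersurfaceComplement ![h] := by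
    rw [mem_affineHypersurfaceComplement_iff]
    intro j
    fin_cases j
    exact hu2
  obtain ⟨c, hcu, -⟩ := exists_pencilCoord_eq_of_coeff 3 d _ (coeffsM 3 d _ F₀) (coeffsM 3 d _ G) (χ.symm ⟨_, hmem⟩) u
    (fun m => by rw [← hχ, Homeomorph.apply_symm_apply]; rfl)
  have hcC : c ∉ C := fun hc => hu1 ⟨c, hc, hcu⟩
  have hΓ := hC c hcC
  -- ### the member `f = F₀ + u·G`
  have hf : (F₀ + MvPolynomial.C u * G).IsHomogeneous d := isHomogeneous_add_C_mul 3 d hF₀ hG u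
  have hev : ∀ e : Fin 5 →₀ ℕ, ¬ Even (e 0 + e 1) → (F₀ + MvPolynomial.C u * G).coeff e = 0 := fun e he => by
    rw [MvPolynomial.coeff_add, MvPolynomial.coeff_C_mul, hevF e he, hevG e he, mul_zero, add_zero]
  obtain ⟨eX⟩ := hcut.nonempty_iso_hypersurface
  have hXF : IsSmoothProjective 3 (SmoothHypersurface.hypersurface (F₀ + MvPolynomial.C u * G)) := hX.of_iso eX
  have hJ : IsNonsingularForm ℂ (F₀ + MvPolynomial.C u * G) := by
    rw [← hcu]; exact isNonsingularForm_pencilCoord 3 d _ hF₀ hG hMF hMG c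
  have ha := signUnits_two_mem_diagonalStabilizer (F₀ + MvPolynomial.C u * G) hev
  -- `(Γ^Zar)⁰ ⊆ MT` at the classifying point of the member
  have hpt : classifyingPoint ℂ 3 d {m : DegIndex 3 d | Even (m.1 0 + m.1 1)} t₀ (F₀ + MvPolynomial.C u * G) =
      AlgPoints.map (pencilMap 3 d _ (coeffsM 3 d _ F₀) (coeffsM 3 d _ G)) c := by
    rw [← hcu]; exact classifyingPoint_eq_map_pencilMap 3 d _ hF₀ hG hMF hMG t₀ c
  have key : ∀ t' : ComplexPoints (baseM ℂ 3 d {m : DegIndex 3 d | Even (m.1 0 + m.1 1)}),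
      t' = AlgPoints.map (pencilMap 3 d _ (coeffsM 3 d _ F₀) (coeffsM 3 d _ G)) c →
      haveI := hfin t'
      glIdentityComponent (ratMonodromyGroup (familyM ℂ 3 d {m : DegIndex 3 d | Even (m.1 0 + m.1 1)}) 3 hU ⟨t', mem_univ _⟩) ⊆
        (((A t').hodgeStructure (hu.isSmoothProjective t') (hA t') 3).mumfordTateGroup :
          Set (bettiCohomology (fiberOver (familyM ℂ 3 d {m : DegIndex 3 d | Even (m.1 0 + m.1 1)}) t') 3 ≃ₗ[ℚ]
            bettiCohomology (fiberOver (familyM ℂ 3 d {m : DegIndex 3 d | Even (m.1 0 + m.1 1)}) t') 3)) := by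
    rintro t' rfl
    exact hΓ
  obtain ⟨⟨h1, h2, h3⟩, hComm⟩ := hK (F₀ + MvPolynomial.C u * G) hf hev hJ hXF ha (key _ hpt)
  -- ### (MT)+(P) model transfer to `X` and K2-B
  exact SignSymmetricPowersClose.powersHodgeOfSignCommutators hd h4 hX ⟨F₀ + MvPolynomial.C u * G, hf, hev, hcut⟩
    ⟨eX.hom ≫ diagonalAut _ ha ≫ eX.inv, ⟨pull_conj_sq_eq_one_of_iso eX h1, tr_cup_pull_conj_of_iso hX hXF eX h2,
      fun j q hj hq => by
        rw [finrank_eigenspace_inf_piece_eq_of_iso exists_isReal_hodgeModel_holds hodgePQ_independent_of_hodgeModel_holds hX hXF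
          eX (diagonalAut _ ha) 3]
        exact h3 j q hj hq⟩,
      comm_of_iso exists_isReal_hodgeModel_holds hodgePQ_independent_of_hodgeModel_holds hX hXF eX (diagonalAut _ ha) 3 hComm⟩ hY

/-! ### §2 The typed target: a Zariski-open set of pencils -/

/-- Evaluating the restricted discriminant at `0`: a homogeneous polynomial of positive degree vanishes at the origin, so
`D_M(0) = Disc(0) = 0` (the zero form is singular). [cite: VoisinHodgeII2003, §6.2.1] -/
theorem eval_zero_killHom_eq_zero {n d : ℕ} (M : Set (DegIndex n d)) [DecidablePred (· ∈ M)]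
    {Disc : MvPolynomial (DegIndex n d) ℂ} (hhom : Disc.IsHomogeneous Disc.totalDegree) (hpos : 0 < Disc.totalDegree) :
    MvPolynomial.eval (0 : M → ℂ) (killHom ℂ n d M Disc) = 0 := by
  rw [SignSymmetricPowersMeridianOneNode.eval_killHom]
  have h0 : (fun m : DegIndex n d => if h : m ∈ M then (0 : M → ℂ) ⟨m, h⟩ else 0) = 0 := by
    funext m
    by_cases hm : m ∈ M
    · rw [dif_pos hm]; rfl
    · rw [dif_neg hm]; rfl
  rw [h0, MvPolynomial.eval_zero]
  change MvPolynomial.coeff 0 Disc = 0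
  exact hhom.coeff_eq_zero (by rw [map_zero]; exact hpos.ne)

/-- **Reading (a″)-B of rung F-H1 from the QUASI-PROJECTIVE form of Griffiths' theorem and hN′** (the statement of
`signThreefoldPowersHodgeGeneralPencil` below, hypothesis weakened to `Griffiths1968_holomorphicHodgeSubbundlesQP` — the form the
cell's programme GRIFFITHS-HOLOMORPHY (prover-Bx g17) discharges).  For every even `d ≥ 4` there is a
polynomial `Q` on PAIRS of degree-`d` quinary coefficient vectors, NON-ZERO AT SOME ι-EVEN PAIR, such that for all ι-even
homogeneous `f₀, g` of degree `d` with `Q(coeff f₀, coeff g) ≠ 0`, all but COUNTABLY many members `f₀ + u·g` of the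
pencil have the Hodge conjecture on all self fibre powers of every smooth projective threefold they cut out in `ℙ⁴`.
`Q = pencilDiscr h′` (renamed to all coefficients) for the reduced equation `h′` of the ι-even discriminant.  CONDITIONAL
on {Griffiths 1968, hN′}; NOT items 19716 ∕ 19715; HC not proved.
[cite: Deligne1972WeilK3, Prop. 7.5] [cite: VoisinHodgeII2003, §3.2.2 Thm. 3.22 and §6.2.1] [cite: Dimca1992, Ch. 4 §3 Prop. (3.1)]
[cite: VoisinHodgeI2002, §10.2.1 Thm. 10.3] -/
theorem signThreefoldPowersHodgeGeneralPencil_QP (hGr : Griffiths1968_holomorphicHodgeSubbundlesQP)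
    (hNC : ∀ (n d : ℕ) (f₁ g₀ g₂ : MvPolynomial (Fin (n + 2)) ℂ) (j k : Fin (n + 2)) (a : Fin (n + 2) → ℂˣ),
      1 ≤ n → 1 ≤ d → Odd n → (∃ (i : Fin (n + 2)) (c : ℂ), g₀ = c • MvPolynomial.X i ^ d) →
      f₁.IsHomogeneous d → g₀.IsHomogeneous d → g₂.IsHomogeneous d → IsSymmetricA3Datum f₁ g₀ g₂ j k a →
      ∀ (εa εb : ℝ) (ψ : ℂ → ℂ), IsSymmetricA3Bifurcation f₁ g₀ g₂ j a εa εb ψ →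
        ∃ εa' : ℝ, 0 < εa' ∧ εa' ≤ εa ∧ SymmetricA3NonCommutation n d f₁ g₀ g₂ ψ εa') :
    ∀ ⦃d : ℕ⦄, Even d → 4 ≤ d →
      ∃ Q : MvPolynomial ({e : Fin 5 →₀ ℕ // e.degree = d} ⊕ {e : Fin 5 →₀ ℕ // e.degree = d}) ℂ,
        (∃ f₀ g : MvPolynomial (Fin 5) ℂ, f₀.IsHomogeneous d ∧ g.IsHomogeneous d ∧
            (∀ e : Fin 5 →₀ ℕ, ¬ Even (e 0 + e 1) → f₀.coeff e = 0) ∧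
            (∀ e : Fin 5 →₀ ℕ, ¬ Even (e 0 + e 1) → g.coeff e = 0) ∧
            MvPolynomial.eval (Sum.elim (fun e : {e : Fin 5 →₀ ℕ // e.degree = d} => f₀.coeff e.1)
              (fun e : {e : Fin 5 →₀ ℕ // e.degree = d} => g.coeff e.1)) Q ≠ 0) ∧
        ∀ f₀ g : MvPolynomial (Fin 5) ℂ, f₀.IsHomogeneous d → g.IsHomogeneous d →
          (∀ e : Fin 5 →₀ ℕ, ¬ Even (e 0 + e 1) → f₀.coeff e = 0) →
          (∀ e : Fin 5 →₀ ℕ, ¬ Even (e 0 + e 1) → g.coeff e = 0) →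
          MvPolynomial.eval (Sum.elim (fun e : {e : Fin 5 →₀ ℕ // e.degree = d} => f₀.coeff e.1)
              (fun e : {e : Fin 5 →₀ ℕ // e.degree = d} => g.coeff e.1)) Q ≠ 0 →
          ∃ C : Set ℂ, C.Countable ∧ ∀ u : ℂ, u ∉ C →
            ∀ ⦃X : SchemeOver ℂ⦄, IsSmoothProjective 3 X →
              IsHypersurfaceCutOutBy 4 (f₀ + MvPolynomial.C u * g) X →
              ∀ ⦃k : ℕ⦄ ⦃Y : SchemeOver ℂ⦄, (∃ π : Fin (k + 1) → (Y ⟶ X), Nonempty (IsLimit (Fan.mk Y π))) →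
                HodgeConjectureFor (3 * (k + 1)) Y := by
  intro d hd h4
  classical
  -- ### an equation of the discriminant and its restriction `D_M = killHom Disc` to the ι-even forms
  obtain ⟨Disc, -, hDhom, hDpos, hV⟩ := exists_irreducible_isHomogeneous_discriminantForm (n := 3) (d := d) (by omega)
  have hrange := SignSymmetricPowersMeridianChart.range_coeffChart_eq 3 d {m : DegIndex 3 d | Even (m.1 0 + m.1 1)} hV
  -- a point `t₀ ∈ S_M(ℂ)` (the ι-even Fermat threefold), whence `D_M ≠ 0`
  obtain ⟨-, ⟨t₀⟩, -⟩ := SignSymmetricPowersFibreCoreB.stub_signFibreCoreC hd h4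
  have ht₀ : MvPolynomial.eval ((coeffVector ℂ 3 d (AlgPoints.map (toBase ℂ 3 d {m : DegIndex 3 d | Even (m.1 0 + m.1 1)}) t₀)) ∘
      (Subtype.val : {m : DegIndex 3 d | Even (m.1 0 + m.1 1)} → DegIndex 3 d))
      (killHom ℂ 3 d {m : DegIndex 3 d | Even (m.1 0 + m.1 1)} Disc) ≠ 0 := by
    have hm : (coeffVector ℂ 3 d (AlgPoints.map (toBase ℂ 3 d {m : DegIndex 3 d | Even (m.1 0 + m.1 1)}) t₀)) ∘
        (Subtype.val : {m : DegIndex 3 d | Even (m.1 0 + m.1 1)} → DegIndex 3 d) ∈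
        Set.range (fun t : ComplexPoints (baseM ℂ 3 d {m : DegIndex 3 d | Even (m.1 0 + m.1 1)}) =>
          (coeffVector ℂ 3 d (AlgPoints.map (toBase ℂ 3 d {m : DegIndex 3 d | Even (m.1 0 + m.1 1)}) t)) ∘
            (Subtype.val : {m : DegIndex 3 d | Even (m.1 0 + m.1 1)} → DegIndex 3 d)) := ⟨t₀, rfl⟩
    rw [hrange] at hm
    exact hm
  have hDM : killHom ℂ 3 d {m : DegIndex 3 d | Even (m.1 0 + m.1 1)} Disc ≠ 0 := fun h0 => ht₀ (by rw [h0, map_zero])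
  -- ### (Z-rad) the reduced equation `h′` of the ι-even singular locus and the coefficient chart onto `ℂ^M ∖ V(h′)`
  obtain ⟨h', -, hz, hQ0⟩ := exists_sameZeros_pencilDiscr_ne_zero hDM
  have hrange' : Set.range (fun t : ComplexPoints (baseM ℂ 3 d {m : DegIndex 3 d | Even (m.1 0 + m.1 1)}) =>
      (coeffVector ℂ 3 d (AlgPoints.map (toBase ℂ 3 d {m : DegIndex 3 d | Even (m.1 0 + m.1 1)}) t)) ∘
        (Subtype.val : {m : DegIndex 3 d | Even (m.1 0 + m.1 1)} → DegIndex 3 d)) = affineHypersurfaceComplement ![h'] := by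
    rw [hrange]
    ext a
    rw [mem_setOf_eq, mem_affineHypersurfaceComplement_iff]
    constructor
    · intro ha j
      fin_cases j
      exact fun h0 => ha ((hz a).1 h0)
    · intro ha h0
      exact ha 0 ((hz a).2 h0)
  let χ : ComplexPoints (baseM ℂ 3 d {m : DegIndex 3 d | Even (m.1 0 + m.1 1)}) ≃ₜ affineHypersurfaceComplement ![h'] :=
    (SignSymmetricPowersMeridianChart.isEmbedding_coeffChart 3 d {m : DegIndex 3 d | Even (m.1 0 + m.1 1)}).toHomeomorph.trans
      (Homeomorph.setCongr hrange')
  have hχ : ∀ (t : ComplexPoints (baseM ℂ 3 d {m : DegIndex 3 d | Even (m.1 0 + m.1 1)}))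
      (m : {m : DegIndex 3 d | Even (m.1 0 + m.1 1)}),
      (χ t : {m : DegIndex 3 d | Even (m.1 0 + m.1 1)} → ℂ) m = MvPolynomial.coeff m.1.1 (pointFormM ℂ 3 d _ t) := by
    intro t m
    change coeffVector ℂ 3 d (AlgPoints.map (toBase ℂ 3 d {m : DegIndex 3 d | Even (m.1 0 + m.1 1)}) t) m.1 = _
    rw [coeffVector_apply]
  -- ### the polynomial `Q` on pairs of coefficient vectors
  refine ⟨MvPolynomial.rename (Sum.map Subtype.val Subtype.val) (pencilDiscr h'), ?_, ?_⟩
  · -- non-vacuity: `pencilDiscr h′ ≠ 0` takes a non-zero value at some pair of `M`-vectors (`ℂ` is infinite)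
    obtain ⟨ab, hab⟩ : ∃ ab : ({m : DegIndex 3 d | Even (m.1 0 + m.1 1)} ⊕ {m : DegIndex 3 d | Even (m.1 0 + m.1 1)}) → ℂ,
        MvPolynomial.eval ab (pencilDiscr h') ≠ 0 := by
      by_contra hcon
      push Not at hcon
      exact hQ0 (MvPolynomial.funext fun x => by rw [hcon x, map_zero])
    let ext : ({m : DegIndex 3 d | Even (m.1 0 + m.1 1)} → ℂ) → (DegIndex 3 d → ℂ) := fun a m =>
      if hm : m ∈ {m : DegIndex 3 d | Even (m.1 0 + m.1 1)} then a ⟨m, hm⟩ else 0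
    have hext_even : ∀ (a : {m : DegIndex 3 d | Even (m.1 0 + m.1 1)} → ℂ) (e : Fin 5 →₀ ℕ), ¬ Even (e 0 + e 1) →
        (formOfCoeffs (ext a)).coeff e = 0 := by
      intro a e he
      by_cases hdeg : e.degree = d
      · have h1 := coeff_formOfCoeffs (ext a) ⟨e, hdeg⟩
        change MvPolynomial.coeff e (formOfCoeffs (ext a)) = _ at h1
        rw [h1]
        exact dif_neg he
      · exact coeff_formOfCoeffs_of_degree_ne (ext a) hdeg
    have hext_coeff : ∀ (a : {m : DegIndex 3 d | Even (m.1 0 + m.1 1)} → ℂ) (m : {m : DegIndex 3 d | Even (m.1 0 + m.1 1)}),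
        (formOfCoeffs (ext a)).coeff m.1.1 = a m := by
      intro a m
      have h1 := coeff_formOfCoeffs (ext a) m.1
      change MvPolynomial.coeff m.1.1 (formOfCoeffs (ext a)) = _ at h1
      rw [h1]
      exact (dif_pos m.2).trans rfl
    refine ⟨formOfCoeffs (ext (ab ∘ Sum.inl)), formOfCoeffs (ext (ab ∘ Sum.inr)), isHomogeneous_formOfCoeffs _,
      isHomogeneous_formOfCoeffs _, hext_even _, hext_even _, ?_⟩
    rw [MvPolynomial.eval_rename]
    have heq : (Sum.elim (fun e : {e : Fin 5 →₀ ℕ // e.degree = d} => (formOfCoeffs (ext (ab ∘ Sum.inl))).coeff e.1)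
        (fun e : {e : Fin 5 →₀ ℕ // e.degree = d} => (formOfCoeffs (ext (ab ∘ Sum.inr))).coeff e.1)) ∘
        Sum.map Subtype.val Subtype.val = ab := by
      funext x
      rcases x with m | m
      · exact hext_coeff _ m
      · exact hext_coeff _ m
    rw [heq]
    exact hab
  · intro F₀ G hF₀ hG hevF hevG hQ'
    have hQ : MvPolynomial.eval (Sum.elim (coeffsM 3 d {m : DegIndex 3 d | Even (m.1 0 + m.1 1)} F₀)
        (coeffsM 3 d {m : DegIndex 3 d | Even (m.1 0 + m.1 1)} G)) (pencilDiscr h') ≠ 0 := by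
      rw [MvPolynomial.eval_rename] at hQ'
      have heq : (Sum.elim (fun e : {e : Fin 5 →₀ ℕ // e.degree = d} => F₀.coeff e.1)
          (fun e : {e : Fin 5 →₀ ℕ // e.degree = d} => G.coeff e.1)) ∘ Sum.map Subtype.val Subtype.val =
          Sum.elim (coeffsM 3 d {m : DegIndex 3 d | Even (m.1 0 + m.1 1)} F₀)
            (coeffsM 3 d {m : DegIndex 3 d | Even (m.1 0 + m.1 1)} G) := by
        funext x
        rcases x with m | m <;> rfl
      rwa [heq] at hQ'
    -- the direction is non-zero: `h′` vanishes at `0` and not at the chart of `t₀`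
    have hx : MvPolynomial.eval (0 : {m : DegIndex 3 d | Even (m.1 0 + m.1 1)} → ℂ)
        (killHom ℂ 3 d {m : DegIndex 3 d | Even (m.1 0 + m.1 1)} Disc) = 0 := eval_zero_killHom_eq_zero _ hDhom hDpos
    have hg : coeffsM 3 d {m : DegIndex 3 d | Even (m.1 0 + m.1 1)} G ≠ 0 := ne_zero_of_pencilDiscr_of_zeros hz hx ht₀ hQ
    exact hodgeConjectureFor_signPowers_offCountable_of_pencil hGr hNC hd h4 χ hχ hF₀ hG hevF hevG hg hQ

/-- **Reading (a″)-B of rung F-H1 — the typed target `SignThreefoldPowersHodgeGeneralPencil` of planner p3's file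
`HOME/p3/pencilB/PencilBTarget.lean`, VERBATIM, from Griffiths' theorem and hN′ (= `PencilBTarget` unfolded, tier t1).**  For every
even `d ≥ 4` there is a polynomial `Q` on PAIRS of degree-`d` quinary coefficient vectors, NON-ZERO AT SOME ι-EVEN PAIR, such that for all
ι-even homogeneous `f₀, g` of degree `d` with `Q(coeff f₀, coeff g) ≠ 0`, all but COUNTABLY many members `f₀ + u·g` of the pencil have the
Hodge conjecture on all self fibre powers of every smooth projective threefold they cut out in `ℙ⁴`.  Via the monotonicity
`griffiths1968QP_of_griffiths1968`.  CONDITIONAL on {Griffiths 1968, hN′}; NOT items 19716 ∕ 19715; HC not proved.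
[cite: Deligne1972WeilK3, Prop. 7.5] [cite: VoisinHodgeII2003, §3.2.2 Thm. 3.22 and §6.2.1] [cite: VoisinHodgeI2002, §10.2.1 Thm. 10.3] -/
theorem signThreefoldPowersHodgeGeneralPencil (hGr : Griffiths1968_holomorphicHodgeSubbundles)
    (hNC : ∀ (n d : ℕ) (f₁ g₀ g₂ : MvPolynomial (Fin (n + 2)) ℂ) (j k : Fin (n + 2)) (a : Fin (n + 2) → ℂˣ),
      1 ≤ n → 1 ≤ d → Odd n → (∃ (i : Fin (n + 2)) (c : ℂ), g₀ = c • MvPolynomial.X i ^ d) →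
      f₁.IsHomogeneous d → g₀.IsHomogeneous d → g₂.IsHomogeneous d → IsSymmetricA3Datum f₁ g₀ g₂ j k a →
      ∀ (εa εb : ℝ) (ψ : ℂ → ℂ), IsSymmetricA3Bifurcation f₁ g₀ g₂ j a εa εb ψ →
        ∃ εa' : ℝ, 0 < εa' ∧ εa' ≤ εa ∧ SymmetricA3NonCommutation n d f₁ g₀ g₂ ψ εa') :
    ∀ ⦃d : ℕ⦄, Even d → 4 ≤ d →
      ∃ Q : MvPolynomial ({e : Fin 5 →₀ ℕ // e.degree = d} ⊕ {e : Fin 5 →₀ ℕ // e.degree = d}) ℂ,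
        (∃ f₀ g : MvPolynomial (Fin 5) ℂ, f₀.IsHomogeneous d ∧ g.IsHomogeneous d ∧
            (∀ e : Fin 5 →₀ ℕ, ¬ Even (e 0 + e 1) → f₀.coeff e = 0) ∧
            (∀ e : Fin 5 →₀ ℕ, ¬ Even (e 0 + e 1) → g.coeff e = 0) ∧
            MvPolynomial.eval (Sum.elim (fun e : {e : Fin 5 →₀ ℕ // e.degree = d} => f₀.coeff e.1)
              (fun e : {e : Fin 5 →₀ ℕ // e.degree = d} => g.coeff e.1)) Q ≠ 0) ∧
        ∀ f₀ g : MvPolynomial (Fin 5) ℂ, f₀.IsHomogeneous d → g.IsHomogeneous d →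
          (∀ e : Fin 5 →₀ ℕ, ¬ Even (e 0 + e 1) → f₀.coeff e = 0) →
          (∀ e : Fin 5 →₀ ℕ, ¬ Even (e 0 + e 1) → g.coeff e = 0) →
          MvPolynomial.eval (Sum.elim (fun e : {e : Fin 5 →₀ ℕ // e.degree = d} => f₀.coeff e.1)
              (fun e : {e : Fin 5 →₀ ℕ // e.degree = d} => g.coeff e.1)) Q ≠ 0 →
          ∃ C : Set ℂ, C.Countable ∧ ∀ u : ℂ, u ∉ C →
            ∀ ⦃X : SchemeOver ℂ⦄, IsSmoothProjective 3 X →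
              IsHypersurfaceCutOutBy 4 (f₀ + MvPolynomial.C u * g) X →
              ∀ ⦃k : ℕ⦄ ⦃Y : SchemeOver ℂ⦄, (∃ π : Fin (k + 1) → (Y ⟶ X), Nonempty (IsLimit (Fan.mk Y π))) →
                HodgeConjectureFor (3 * (k + 1)) Y :=
  signThreefoldPowersHodgeGeneralPencil_QP (griffiths1968QP_of_griffiths1968 hGr) hNC

/-! ### §3 Tier t2: hN′ discharged (`WeightedPencil.symmetricA3NonCommutation_mono_holds`, seat 20241-p1, p691969) -/

/-- **Reading (a″)-B modulo the QUASI-PROJECTIVE Griffiths theorem ONLY**: hN′ is the tree theorem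
`WeightedPencil.symmetricA3NonCommutation_mono_holds` (seat 20241-p1 over prover-Bx's A₃-TRACE port).  This is the statement the cell's
programme GRIFFITHS-HOLOMORPHY turns UNCONDITIONAL by one application.  CONDITIONAL on `Griffiths1968_holomorphicHodgeSubbundlesQP`;
NOT items 19716 ∕ 19715; HC not proved. [cite: Deligne1972WeilK3, Prop. 7.5] [cite: VoisinHodgeII2003, §3.2.2 Thm. 3.22 and §6.2.1]
[cite: VoisinHodgeI2002, §10.2.1 Thm. 10.3] -/
theorem signThreefoldPowersHodgeGeneralPencil_of_griffithsQP (hGr : Griffiths1968_holomorphicHodgeSubbundlesQP) :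
    ∀ ⦃d : ℕ⦄, Even d → 4 ≤ d →
      ∃ Q : MvPolynomial ({e : Fin 5 →₀ ℕ // e.degree = d} ⊕ {e : Fin 5 →₀ ℕ // e.degree = d}) ℂ,
        (∃ f₀ g : MvPolynomial (Fin 5) ℂ, f₀.IsHomogeneous d ∧ g.IsHomogeneous d ∧
            (∀ e : Fin 5 →₀ ℕ, ¬ Even (e 0 + e 1) → f₀.coeff e = 0) ∧
            (∀ e : Fin 5 →₀ ℕ, ¬ Even (e 0 + e 1) → g.coeff e = 0) ∧
            MvPolynomial.eval (Sum.elim (fun e : {e : Fin 5 →₀ ℕ // e.degree = d} => f₀.coeff e.1)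
              (fun e : {e : Fin 5 →₀ ℕ // e.degree = d} => g.coeff e.1)) Q ≠ 0) ∧
        ∀ f₀ g : MvPolynomial (Fin 5) ℂ, f₀.IsHomogeneous d → g.IsHomogeneous d →
          (∀ e : Fin 5 →₀ ℕ, ¬ Even (e 0 + e 1) → f₀.coeff e = 0) →
          (∀ e : Fin 5 →₀ ℕ, ¬ Even (e 0 + e 1) → g.coeff e = 0) →
          MvPolynomial.eval (Sum.elim (fun e : {e : Fin 5 →₀ ℕ // e.degree = d} => f₀.coeff e.1)
              (fun e : {e : Fin 5 →₀ ℕ // e.degree = d} => g.coeff e.1)) Q ≠ 0 →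
          ∃ C : Set ℂ, C.Countable ∧ ∀ u : ℂ, u ∉ C →
            ∀ ⦃X : SchemeOver ℂ⦄, IsSmoothProjective 3 X →
              IsHypersurfaceCutOutBy 4 (f₀ + MvPolynomial.C u * g) X →
              ∀ ⦃k : ℕ⦄ ⦃Y : SchemeOver ℂ⦄, (∃ π : Fin (k + 1) → (Y ⟶ X), Nonempty (IsLimit (Fan.mk Y π))) →
                HodgeConjectureFor (3 * (k + 1)) Y :=
  signThreefoldPowersHodgeGeneralPencil_QP hGr WeightedPencil.symmetricA3NonCommutation_mono_holds

/-- **Reading (a″)-B modulo Griffiths' theorem ONLY** (tier t2 of p3's rung proposal F-H1-B(a″)): the keyed symmetric-`A₃` binder hN′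
is the tree theorem `WeightedPencil.symmetricA3NonCommutation_mono_holds` (seat 20241-p1, prover-Bx's A₃-TRACE port), so the general-pencil statement
holds for every even `d ≥ 4` granted `Griffiths1968_holomorphicHodgeSubbundles` alone.  CONDITIONAL on that print theorem; NOT items
19716 ∕ 19715; HC not proved. [cite: Deligne1972WeilK3, Prop. 7.5] [cite: VoisinHodgeII2003, §3.2.2 Thm. 3.22 and §6.2.1]
[cite: VoisinHodgeI2002, §10.2.1 Thm. 10.3] -/
theorem signThreefoldPowersHodgeGeneralPencil_of_griffiths (hGr : Griffiths1968_holomorphicHodgeSubbundles) :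
    ∀ ⦃d : ℕ⦄, Even d → 4 ≤ d →
      ∃ Q : MvPolynomial ({e : Fin 5 →₀ ℕ // e.degree = d} ⊕ {e : Fin 5 →₀ ℕ // e.degree = d}) ℂ,
        (∃ f₀ g : MvPolynomial (Fin 5) ℂ, f₀.IsHomogeneous d ∧ g.IsHomogeneous d ∧
            (∀ e : Fin 5 →₀ ℕ, ¬ Even (e 0 + e 1) → f₀.coeff e = 0) ∧
            (∀ e : Fin 5 →₀ ℕ, ¬ Even (e 0 + e 1) → g.coeff e = 0) ∧
            MvPolynomial.eval (Sum.elim (fun e : {e : Fin 5 →₀ ℕ // e.degree = d} => f₀.coeff e.1)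
              (fun e : {e : Fin 5 →₀ ℕ // e.degree = d} => g.coeff e.1)) Q ≠ 0) ∧
        ∀ f₀ g : MvPolynomial (Fin 5) ℂ, f₀.IsHomogeneous d → g.IsHomogeneous d →
          (∀ e : Fin 5 →₀ ℕ, ¬ Even (e 0 + e 1) → f₀.coeff e = 0) →
          (∀ e : Fin 5 →₀ ℕ, ¬ Even (e 0 + e 1) → g.coeff e = 0) →
          MvPolynomial.eval (Sum.elim (fun e : {e : Fin 5 →₀ ℕ // e.degree = d} => f₀.coeff e.1)
              (fun e : {e : Fin 5 →₀ ℕ // e.degree = d} => g.coeff e.1)) Q ≠ 0 →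
          ∃ C : Set ℂ, C.Countable ∧ ∀ u : ℂ, u ∉ C →
            ∀ ⦃X : SchemeOver ℂ⦄, IsSmoothProjective 3 X →
              IsHypersurfaceCutOutBy 4 (f₀ + MvPolynomial.C u * g) X →
              ∀ ⦃k : ℕ⦄ ⦃Y : SchemeOver ℂ⦄, (∃ π : Fin (k + 1) → (Y ⟶ X), Nonempty (IsLimit (Fan.mk Y π))) →
                HodgeConjectureFor (3 * (k + 1)) Y :=
  signThreefoldPowersHodgeGeneralPencil_of_griffithsQP (griffiths1968QP_of_griffiths1968 hGr)

end Summit.HodgeConjecture.HodgeConjecture.Theorems.SignSymmetricPowersGeneralPencil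

end
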